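import Literature.Computability.MetaComplexity.WSOIProgram
import Literature.Computability.MetaComplexity.UPSearchScheme
import Literature.Computability.FineGrained.SchoeningWalk
import HarnessLib

/-!
# Complexity meta: Hirahara's Thm. 5.2 (weak symmetry of information) from a quick pseudorandom generator and `Gap(K vs K) ∈ pr-P`

Topic `Literature/Computability/MetaComplexity`. S. Hirahara, *Average-case hardness of NP from
exponential worst-case hardness assumptions*, STOC 2021 (ECCC TR21-058), Thm. 5.2 (p. 30):

> "If `coNP × {U, T} ⊆ Avg¹_{1−n^{−c}}P` for some constant `c`, then there exist polynomials `p₀` and `p_w`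
> such that, for any `n, m ∈ ℕ`, any `t ≥ p₀(nm)`, any `δ > 0`, and any `x ∈ {0,1}ⁿ`,
> `Pr_{w ∼ {0,1}ᵐ}[K^t(xw) ≥ K^{p_w(t/δ)}(x) + m − log p_w(t/δ)] ≥ 1 − δ`."

The printed proof uses the average-case hypothesis only through Lemma 5.1 (`Gap(K vs K) ∈ pr-P`) and
Thm. 3.12 (whose hypothesis is the generator of Lemma 3.4). This file proves the theorem from exactly
these two inputs, in the form consumed downstream (`δ = 1/e`; the hypothesis `h52` of
`Cryptography.hirahara_UP_DistNP_of_nonempty_of_languageCompression`):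

* `Hirahara2021_weakSOI_of_PRG` — **for every efficient universal machine `U`: if a quick
  logarithmic-seed generator fools linear-size circuits for all large output lengths and
  `Gap_τ(K vs K) ∈ pr-P` for some polynomial `τ`, then there are polynomials `p₀, p_w` with
  `Pr_w[K^{p_w(te)}(x) + m ≤ K^t(xw) + ⌊log₂ p_w(te)⌋] ≥ 1 − 1/e` for all `n, m, t ≥ p₀(nm), e ≥ 1`,
  `x ∈ {0,1}ⁿ`.**

Proof as printed (p. 30), with the tree's tools: the separator `L_A ∈ P` of `Gap_τ(K vs K)` gives the
test `(ω; w) ↦ A(ω w; 1^T, 1ˢ)` (`WSOIProg.testLang`); few uniform strings make `A` accept (Fact 3.7,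
`UniversalMachine.ncard_setOf_ktAt_lt`); if `A` accepted `DP_k(x; z) w` with probability `≥ 1/e` the test
would `1/2e`-distinguish `DP_k(x; ·)`, so Thm. 3.12 (`Hirahara2021_dpReconstructionK`) would give
`K^{p(N)}(x) ≤ k + 2W + log p(N)`, contradicting the choice `k := K^{p(N̄)}(x) − 2W − log p(N̄) − 1`;
hence with probability `> 1 − 1/e` the instance is not a yes-instance, `K^T(DP_k(x; z) w) > s`, and the
description of `DP_k(x; z) w` from a program for `xw` (`WSOIProg.exists_ktAt_dpGen_append_le`) turns
this into the claimed lower bound on `K^t(xw)`. The degenerate regimes (`k = 0`, short `xw`) are the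
counting bound `#{y | K^t(y) < r} < 2ʳ` applied to `w ↦ xw`.

## References

* S. Hirahara, ECCC TR21-058 (2021): Thm. 5.2 and its proof (p. 30), Lemma 5.1, Thm. 3.12, Fact 3.7.
* A. K. Zvonkin, L. A. Levin, Russian Math. Surveys 25 (1970), Thm. 5.2 (symmetry of information).
-/

noncomputable section

namespace Literature.Computability.MetaComplexity

open _root_.Computability Polynomial Complexity Complexity.Brick Filter Finset
open Literature.Computability.Cryptography Literature.Computability.AlgebraicComplexity

namespace WSOI

/-! ### Counting helpers -/

/-- The counting probability of an event is at most the size of any finite set into which its length-`m`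
part injects, over `2ᵐ`. [folklore] -/
private theorem uniformProb_le_ncard_div {m : ℕ} {E S : Set (List Bool)} (hS : S.Finite) (f : List Bool → List Bool) (hf : Function.Injective f)
    (h : ∀ y : List Bool, y.length = m → y ∈ E → f y ∈ S) :
    uniformProb m E ≤ S.ncard / 2 ^ m := by
  classical
  unfold uniformProb
  refine div_le_div_of_nonneg_right ?_ (by positivity)
  have hle : (univ.filter fun r : List.Vector Bool m => r.toList ∈ E).card ≤ hS.toFinset.card := by
    refine Finset.card_le_card_of_injOn (fun r => f r.toList) (fun r hr => ?_) fun r _ r' _ hrr => List.Vector.toList_injective (hf hrr)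
    rw [Finset.mem_coe, mem_filter] at hr
    rw [Finset.mem_coe, Set.Finite.mem_toFinset]
    exact h _ (by simp) hr.2
  rw [Set.ncard_eq_toFinset_card _ hS]
  exact_mod_cast hle

/-- An event with no member of length `m` has counting probability `0` (cf. `BPExp.uniformProb_eq_zero_of_forall`,
not importable here without its machine files). [folklore] -/
private theorem uniformProb_eq_zero_of_forall {m : ℕ} {E : Set (List Bool)} (h : ∀ y : List Bool, y.length = m → y ∉ E) : uniformProb m E = 0 := by
  have := uniformProb_le_ncard_div (E := E) (m := m) Set.finite_empty id Function.injective_id fun y hy hyE => absurd hyE (h y hy)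
  rw [Set.ncard_empty, Nat.cast_zero, zero_div] at this
  exact le_antisymm this (uniformProb_nonneg _ _)

/-- Monotonicity of the counting probability along an inclusion of the length-`m` parts. [folklore] -/
private theorem uniformProb_mono_len {m : ℕ} {E E' : Set (List Bool)} (h : ∀ y : List Bool, y.length = m → y ∈ E → y ∈ E') :
    uniformProb m E ≤ uniformProb m E' := by
  classical
  unfold uniformProb
  refine div_le_div_of_nonneg_right ?_ (by positivity)
  exact_mod_cast Finset.card_le_card fun r hr => by
    simp only [Finset.mem_filter, Finset.mem_univ, true_and] at hr ⊢
    exact h _ (by simp) hr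

/-- **The counting regime**: if `K^{T'}(x) ≤ G`, `G + g ≤ LOG` and `2^g > 2e`, then
`Pr_w[K^{T'}(x) + m ≤ K^t(xw) + LOG] ≥ 1 − 1/e` — the strings `xw` with `K^t(xw) < G + m − LOG` are
fewer than `2^{G+m−LOG} ≤ 2ᵐ/2^g` (`UniversalMachine.ncard_setOf_ktAt_lt`, `w ↦ xw` injective).
[Hirahara 2021 (ECCC TR21-058), Fact 3.7] [cite: Hirahara2021, Fact 3.7] -/
theorem counting_regime (U : UniversalMachine) (x : List Bool) {m t T' LOG G g e : ℕ} (he : 1 ≤ e)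
    (hK : U.ktAt T' x ≤ G) (hlog : G + g ≤ LOG) (hg : 2 * e < 2 ^ g) :
    1 - 1 / (e : ℝ) ≤ uniformProb m {w | U.ktAt T' x + m ≤ U.ktAt t (x ++ w) + LOG} := by
  set E : Set (List Bool) := {w | U.ktAt T' x + m ≤ U.ktAt t (x ++ w) + LOG} with hE
  have he' : (0 : ℝ) < e := by exact_mod_cast he
  have hcompl : uniformProb m E = 1 - uniformProb m Eᶜ := by rw [uniformProb_compl]; ring
  rw [hcompl]
  suffices hbad : uniformProb m Eᶜ ≤ 1 / e by linarith
  -- a bad `w` has `K^t(xw) < G + m - LOG`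
  have hbad_lt : ∀ w ∈ Eᶜ, U.ktAt t (x ++ w) < ((G + m - LOG : ℕ) : ℕ∞) := by
    intro w hw
    simp only [Set.mem_compl_iff, hE, Set.mem_setOf_eq, not_le] at hw
    have hlt : U.ktAt t (x ++ w) + LOG < (G : ℕ∞) + m := lt_of_lt_of_le hw (add_le_add hK le_rfl)
    have hne : U.ktAt t (x ++ w) ≠ ⊤ := by
      intro htop; rw [htop, top_add] at hlt; exact not_top_lt hlt
    obtain ⟨a, ha⟩ := ENat.ne_top_iff_exists.mp hne
    rw [← ha] at hlt ⊢
    have : a + LOG < G + m := by exact_mod_cast hlt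
    exact_mod_cast (show a < G + m - LOG by omega)
  by_cases hr : G + m ≤ LOG
  · -- no bad strings at all
    have h0 : uniformProb m Eᶜ = 0 := uniformProb_eq_zero_of_forall fun y _ hy => by
      have := hbad_lt y hy
      rw [Nat.sub_eq_zero_of_le hr] at this
      simp at this
    rw [h0]; positivity
  · push Not at hr
    set r := G + m - LOG with hrdef
    have hrg : r + g ≤ m := by omega
    have hS := U.finite_setOf_ktAt_lt t r
    have hcard := U.ncard_setOf_ktAt_lt t r
    have hle : uniformProb m Eᶜ ≤ ({y | U.ktAt t y < r} : Set (List Bool)).ncard / 2 ^ m :=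
      uniformProb_le_ncard_div hS (fun y => x ++ y) (List.append_right_injective x) fun y _ hy => hbad_lt y hy
    refine hle.trans ?_
    rw [div_le_div_iff₀ (by positivity) he', one_mul]
    have h1 : (({y | U.ktAt t y < r} : Set (List Bool)).ncard : ℝ) * e ≤ 2 ^ r * e := by
      have : (({y | U.ktAt t y < r} : Set (List Bool)).ncard : ℝ) ≤ 2 ^ r := by exact_mod_cast hcard.le
      exact mul_le_mul_of_nonneg_right this he'.le
    have h2 : (2 : ℝ) ^ r * e ≤ 2 ^ m := by
      have h3 : (2 : ℝ) ^ r * (2 * e) ≤ 2 ^ r * 2 ^ g := by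
        have : (2 : ℝ) * e ≤ 2 ^ g := by exact_mod_cast hg.le
        exact mul_le_mul_of_nonneg_left this (by positivity)
      have h4 : (2 : ℝ) ^ r * 2 ^ g ≤ 2 ^ m := by
        rw [← pow_add]; exact pow_le_pow_right₀ (by norm_num) hrg
      nlinarith [h3, h4, show (0 : ℝ) ≤ 2 ^ r * e by positivity]
    linarith

/-- Unary numerals are blocks of `1`s. [folklore] -/
private theorem unary_eq_ones (n : ℕ) : unaryEncodeNat n = ones n := Complexity.unaryEncodeNat_eq_replicate n

/-- `2e < 2^{⌊log₂(2e)⌋ + 1}`. [folklore] -/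
theorem two_mul_lt_two_pow_log (e : ℕ) : 2 * e < 2 ^ (Nat.log 2 (2 * e) + 1) := Nat.lt_pow_succ_log_self one_lt_two _

/-! ### Few uniform strings pass the `Gap(K vs K)` test -/

/-- **Few uniform strings make the `Gap(K vs K)` algorithm accept** (the first inequality of the proof of
Thm. 5.2: "`Pr_{ω,w}[A(ω w; 1^{2t}; 1ˢ) = 1] ≤ Pr[K(ω w) ≤ s + log τ(…)] ≤ δ/2`, where the last inequality
follows from Fact 3.7"): if `L_A` avoids the no-instances of `Gap_τ(K vs K)` and
`s + ⌊log₂ τ(Y+T)⌋ + 1 + (⌊log₂ 2e⌋ + 2) ≤ Y`, then at most a `1/2e` fraction of the strings `y ∈ {0,1}^Y`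
have `⟨⟨1^T, ⟨s⟩⟩, y⟩` in the test language. [Hirahara 2021 (ECCC TR21-058), proof of Thm. 5.2, Fact 3.7]
[cite: Hirahara2021, Thm. 5.2 (proof)] -/
theorem uniformProb_test_le (U : UniversalMachine) {τ : ℕ → ℕ} {LA : Language Bool} (hno : (U.gapKvsK τ).no ≤ LAᶜ)
    {T s Y e : ℕ} {bs : List Bool} (he : 1 ≤ e) (hbs : bitsToNat bs = s)
    (hY : s + Nat.log 2 (τ (Y + T)) + 1 + (Nat.log 2 (2 * e) + 2) ≤ Y) :
    uniformProb Y {y | boolPair (boolPair (unaryEncodeNat T) bs) y ∈ WSOIProg.testLang LA} ≤ 1 / (2 * (e : ℝ)) := by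
  have he' : (0 : ℝ) < e := by exact_mod_cast he
  set r := s + Nat.log 2 (τ (Y + T)) + 1 with hr
  have hS := U.finite_setOf_ktAt_lt (τ (Y + T)) r
  have hcard := U.ncard_setOf_ktAt_lt (τ (Y + T)) r
  have hsub : ∀ y : List Bool, y.length = Y → boolPair (boolPair (unaryEncodeNat T) bs) y ∈ WSOIProg.testLang LA →
      y ∈ ({y | U.ktAt (τ (Y + T)) y < r} : Set (List Bool)) := by
    intro y hy hmem
    rw [unary_eq_ones, WSOIProg.boolPair_mem_testLang, hbs, hy, min_eq_left (by omega), ← unary_eq_ones, ← unary_eq_ones] at hmem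
    have hnotno : boolPair y (boolPair (unaryEncodeNat T) (unaryEncodeNat s)) ∉ (U.gapKvsK τ).no := fun h => hno h hmem
    rw [U.boolPair_mem_gapKvsK_no_iff, not_lt, hy] at hnotno
    show U.ktAt (τ (Y + T)) y < ((r : ℕ) : ℕ∞)
    rw [hr]
    exact lt_of_le_of_lt hnotno (by exact_mod_cast Nat.lt_succ_self _)
  refine (uniformProb_le_ncard_div hS id Function.injective_id hsub).trans ?_
  rw [div_le_div_iff₀ (by positivity) (by positivity), one_mul]
  have h1 : (({y | U.ktAt (τ (Y + T)) y < r} : Set (List Bool)).ncard : ℝ) ≤ 2 ^ r := by exact_mod_cast hcard.le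
  have h2 : (2 : ℝ) ^ r * (2 * (2 * e)) ≤ 2 ^ Y := by
    have h3 : (2 : ℝ) * e < 2 ^ (Nat.log 2 (2 * e) + 1) := by exact_mod_cast two_mul_lt_two_pow_log e
    have h4 : (2 : ℝ) ^ r * 2 ^ (Nat.log 2 (2 * e) + 2) ≤ 2 ^ Y := by
      rw [← pow_add]; exact pow_le_pow_right₀ (by norm_num) (by omega)
    have h5 : (2 : ℝ) * (2 * e) ≤ 2 ^ (Nat.log 2 (2 * e) + 2) := by rw [pow_succ]; linarith
    nlinarith [h4, h5, show (0 : ℝ) ≤ 2 ^ r by positivity]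
  nlinarith [h1, h2, show (0 : ℝ) ≤ 2 * (e : ℝ) by positivity, show (0 : ℝ) ≤ 2 ^ r by positivity]

/-! ### The parameters as functions of `v = t·e` -/

section Params

variable (a₀ dD dp dτ : ℕ) (p : Polynomial ℕ)

/-- Bound on the ruler of the description program: `n + (n + a₀) + t ≤ 3v + a₀`. [folklore] -/
def RDb (v : ℕ) : ℕ := 3 * v + a₀
/-- Bound on the payload of the description program. [folklore] -/
def PLDb (v : ℕ) : ℕ := 2 * (5 * (Nat.log 2 (RDb a₀ v) + 1) + 4) + 2 + (v + a₀) * v + (v + v + a₀ + 1)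
/-- **The time `T` of the `Gap(K vs K)` instances** (above the budget of the description bound). [folklore] -/
def Tf (v : ℕ) : ℕ := (2 * RDb a₀ v + PLDb a₀ v + 2) ^ (2 ^ dD)
/-- Bound on `Y = nk + k + m`. [folklore] -/
def Yb (v : ℕ) : ℕ := (v + a₀) * v + (v + a₀) + v
/-- Bound on the width `W` of the binary threshold. [folklore] -/
def Wb (v : ℕ) : ℕ := Nat.log 2 (Yb a₀ v) + 1
/-- Bound `N̄ ≤ Nb` on the size fed to Thm. 3.12. [folklore] -/
def Nb (v : ℕ) : ℕ := Tf a₀ dD v + v + (v + a₀) + v + 2 * v + Wb a₀ v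
/-- **The master bound `Z`**: every logarithm of the proof is `≤ ⌊log₂ Z⌋`. [folklore] -/
def Zf (v : ℕ) : ℕ := p.eval (Nb a₀ dD v) + 2 + (Yb a₀ v + Tf a₀ dD v + 2) ^ (2 ^ dτ) + RDb a₀ v + (Yb a₀ v + 1) + 2 * v

/-- `RDb` is polynomially bounded. [folklore] -/
theorem isPBounded_RDb : IsPBounded (RDb a₀) :=
  IsPBounded.add_holds (IsPBounded.mul_holds (IsPBounded.const 3) IsPBounded.id) (IsPBounded.const a₀)
/-- `PLDb` is polynomially bounded. [folklore] -/
theorem isPBounded_PLDb : IsPBounded (PLDb a₀) := by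
  have hlog : IsPBounded fun v => Nat.log 2 (RDb a₀ v) := (isPBounded_RDb a₀).mono fun v => Nat.log_le_self 2 _
  unfold PLDb
  exact IsPBounded.add_holds (IsPBounded.add_holds (IsPBounded.add_holds (IsPBounded.mul_holds (IsPBounded.const 2)
    (IsPBounded.add_holds (IsPBounded.mul_holds (IsPBounded.const 5) (IsPBounded.add_holds hlog (IsPBounded.const 1))) (IsPBounded.const 4)))
    (IsPBounded.const 2)) (IsPBounded.mul_holds (IsPBounded.add_holds IsPBounded.id (IsPBounded.const a₀)) IsPBounded.id))
    (IsPBounded.add_holds (IsPBounded.add_holds (IsPBounded.add_holds IsPBounded.id IsPBounded.id) (IsPBounded.const a₀)) (IsPBounded.const 1))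
/-- `Tf` is polynomially bounded. [folklore] -/
theorem isPBounded_Tf : IsPBounded (Tf a₀ dD) := by
  unfold Tf
  exact IsPBounded.pow_holds (IsPBounded.add_holds (IsPBounded.add_holds (IsPBounded.mul_holds (IsPBounded.const 2) (isPBounded_RDb a₀))
    (isPBounded_PLDb a₀)) (IsPBounded.const 2)) _
/-- `Yb` is polynomially bounded. [folklore] -/
theorem isPBounded_Yb : IsPBounded (Yb a₀) := by
  unfold Yb
  exact IsPBounded.add_holds (IsPBounded.add_holds (IsPBounded.mul_holds (IsPBounded.add_holds IsPBounded.id (IsPBounded.const a₀)) IsPBounded.id)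
    (IsPBounded.add_holds IsPBounded.id (IsPBounded.const a₀))) IsPBounded.id
/-- `Wb` is polynomially bounded. [folklore] -/
theorem isPBounded_Wb : IsPBounded (Wb a₀) :=
  IsPBounded.add_holds ((isPBounded_Yb a₀).mono fun _ => Nat.log_le_self 2 _) (IsPBounded.const 1)
/-- `Nb` is polynomially bounded. [folklore] -/
theorem isPBounded_Nb : IsPBounded (Nb a₀ dD) := by
  unfold Nb
  exact IsPBounded.add_holds (IsPBounded.add_holds (IsPBounded.add_holds (IsPBounded.add_holds (IsPBounded.add_holds (isPBounded_Tf a₀ dD)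
    IsPBounded.id) (IsPBounded.add_holds IsPBounded.id (IsPBounded.const a₀))) IsPBounded.id) (IsPBounded.mul_holds (IsPBounded.const 2) IsPBounded.id))
    (isPBounded_Wb a₀)
/-- `Zf` is polynomially bounded. [folklore] -/
theorem isPBounded_Zf : IsPBounded (Zf a₀ dD dτ p) := by
  have hp : IsPBounded fun v => p.eval (Nb a₀ dD v) := IsPBounded.comp_holds (DPK.isPBounded_eval p) (isPBounded_Nb a₀ dD)
  unfold Zf
  exact IsPBounded.add_holds (IsPBounded.add_holds (IsPBounded.add_holds (IsPBounded.add_holds (IsPBounded.add_holds hp (IsPBounded.const 2))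
    (IsPBounded.pow_holds (IsPBounded.add_holds (IsPBounded.add_holds (isPBounded_Yb a₀) (isPBounded_Tf a₀ dD)) (IsPBounded.const 2)) _))
    (isPBounded_RDb a₀)) (IsPBounded.add_holds (isPBounded_Yb a₀) (IsPBounded.const 1))) (IsPBounded.mul_holds (IsPBounded.const 2) IsPBounded.id)

end Params

/-! ### The theorem -/

/-- **Hirahara 2021, Thm. 5.2 (weak symmetry of information), from a quick pseudorandom generator and
`Gap(K vs K) ∈ pr-P`.** For every efficient universal machine `U`: if `s ↦ F⟨1^N, s⟩↾N` (`F ∈ FP`, seed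
`c⌊log₂ N⌋ + c`) is `SIZE(N)`-pseudorandom for all large `N` (the generator of Lemma 3.4) and
`Gap_τ(K vs K) ∈ pr-P` for a polynomial `τ` (Lemma 5.1), then there are polynomials `p₀, p_w` such that
for all `n, m, t, e` with `t ≥ p₀(nm)`, `e ≥ 1` and every `x ∈ {0,1}ⁿ`,
`Pr_{w ∈ {0,1}ᵐ}[K^{p_w(te)}(x) + m ≤ K^t(xw) + ⌊log₂ p_w(te)⌋] ≥ 1 − 1/e` — the printed statement with
`δ = 1/e`, in the form of the hypothesis `h52` of
`Cryptography.hirahara_UP_DistNP_of_nonempty_of_languageCompression`. Proof as printed (p. 30): see the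
module docstring. [Hirahara 2021 (ECCC TR21-058), Thm. 5.2 (p. 30), with Lemma 5.1, Thm. 3.12, Fact 3.7]
[cite: Hirahara2021, Thm. 5.2] -/
theorem Hirahara2021_weakSOI_of_PRG (U : UniversalMachine)
    (hPRG : ∃ (F : List Bool → List Bool) (c : ℕ), F ∈ FP ∧
      ∀ᶠ N in atTop, IsSizePseudorandom (seedGenerator F (c * Nat.log 2 N + c) N))
    (h51 : ∃ τ : Polynomial ℕ, U.gapKvsK (fun m => τ.eval m) ∈ PromiseP) :
    ∃ p₀ pw : Polynomial ℕ, ∀ (n m t e : ℕ) (x : List Bool), x.length = n → p₀.eval (n * m) ≤ t → 1 ≤ e →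
      1 - 1 / (e : ℝ) ≤ uniformProb m {w | U.ktAt (pw.eval (t * e)) x + m ≤ U.ktAt t (x ++ w) + Nat.log 2 (pw.eval (t * e))} := by
  classical
  obtain ⟨τ, hτ⟩ := h51
  obtain ⟨LA, hLA, hyes, hno⟩ := hτ
  obtain ⟨c₀, a₀, hprint⟩ := U.exists_ktAt_le_length_add
  -- Thm. 3.12 for the test, with the polynomial enlarged above `c₀`
  obtain ⟨p₁, hp₁⟩ := DPK.Hirahara2021_dpReconstructionK U hPRG (WSOIProg.testLang_mem_P (LA := LA) hLA)
  set p : Polynomial ℕ := p₁ + Polynomial.C c₀ with hpdef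
  have hpeval : ∀ N, p.eval N = p₁.eval N + c₀ := fun N => by simp [hpdef]
  have hp : ∀ (T : ℕ) (bs x : List Bool) (k m e : ℕ), 1 ≤ e →
      1 / (e : ℝ) ≤ |uniformProb (x.length * k + m)
            {zr | boolPair (boolPair (unaryEncodeNat T) bs) (dpGen k x (zr.take (x.length * k)) ++ zr.drop (x.length * k)) ∈ WSOIProg.testLang LA} -
          uniformProb (x.length * k + k + m) {y | boolPair (boolPair (unaryEncodeNat T) bs) y ∈ WSOIProg.testLang LA}| →
      U.ktAt (p.eval (T + x.length + k + m + e + bs.length)) x ≤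
        ((k + 2 * bs.length + Nat.log 2 (p.eval (T + x.length + k + m + e + bs.length)) : ℕ) : ℕ∞) := by
    intro T bs x k m e he hgap
    have h := hp₁ T bs x k m e he hgap
    rw [hpeval]
    refine (U.ktAt_anti (Nat.le_add_right _ _) x).trans (h.trans ?_)
    exact_mod_cast Nat.add_le_add_left (Nat.log_mono_right (Nat.le_add_right _ _)) _
  have hpc₀ : ∀ N, c₀ ≤ p.eval N := fun N => by rw [hpeval]; omega
  -- the description program
  obtain ⟨cD, qD, hD⟩ := WSOIProg.exists_ktAt_dpGen_append_le U
  obtain ⟨dD, -, hdD⟩ := UHSParam.exists_pow_bound qD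
  obtain ⟨dτ, -, hdτ⟩ := UHSParam.exists_pow_bound τ
  -- polynomial majorants
  obtain ⟨PZ, hPZ⟩ := (isPBounded_iff_exists_polynomial_holds _).1 (isPBounded_Zf a₀ dD dτ p)
  set A : ℕ := cD + a₀ + 40 with hA
  refine ⟨X + Polynomial.C (c₀ + 2), Polynomial.C (2 ^ A) * (PZ + Polynomial.C 2) ^ A + PZ + X + Polynomial.C c₀,
    fun n m t e x hx ht he => ?_⟩
  set v := t * e with hv
  have hpw : (Polynomial.C (2 ^ A) * (PZ + Polynomial.C 2) ^ A + PZ + X + Polynomial.C c₀).eval v =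
      2 ^ A * (PZ.eval v + 2) ^ A + PZ.eval v + v + c₀ := by
    simp only [eval_add, eval_mul, eval_pow, eval_C, eval_X]
  rw [hpw]
  set PW := 2 ^ A * (PZ.eval v + 2) ^ A + PZ.eval v + v + c₀ with hPW
  have ht' : n * m + (c₀ + 2) ≤ t := by simpa only [eval_add, eval_X, eval_C] using ht
  have he' : (0 : ℝ) < e := by exact_mod_cast he
  have htv : t ≤ v := by rw [hv]; exact Nat.le_mul_of_pos_right t he
  have hev : e ≤ v := by rw [hv]; exact Nat.le_mul_of_pos_left e (by omega)
  have hc₀t : c₀ ≤ t := by omega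
  have hPWt : t ≤ PW := by rw [hPW]; omega
  have hPWc₀ : c₀ ≤ PW := by rw [hPW]; omega
  -- the master bound and its logarithm
  set Z := Zf a₀ dD dτ p v with hZ
  have hZP : Z ≤ PZ.eval v := hPZ v
  set LZ := Nat.log 2 (PZ.eval v) with hLZ
  have hlogPW : A * (LZ + 1) ≤ Nat.log 2 PW := by
    rw [hPW, hLZ, show 2 ^ A * (PZ.eval v + 2) ^ A + PZ.eval v + v + c₀ = 2 ^ A * (PZ.eval v + 2) ^ A + (PZ.eval v + v + c₀) by ring]
    exact DPK.log_budget le_rfl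
  have hlogZ : Nat.log 2 Z ≤ LZ := Nat.log_mono_right hZP
  have hlinPW : cD + a₀ + 40 * LZ + 40 ≤ Nat.log 2 PW := by
    have h1 : cD * 1 ≤ cD * (LZ + 1) := Nat.mul_le_mul_left _ (by omega)
    have h2 : a₀ * 1 ≤ a₀ * (LZ + 1) := Nat.mul_le_mul_left _ (by omega)
    have h3 : (cD + a₀ + 40) * (LZ + 1) = cD * (LZ + 1) + a₀ * (LZ + 1) + 40 * (LZ + 1) := by ring
    rw [hA] at hlogPW
    omega
  -- `m = 0`: the only `w` is `ε`
  rcases Nat.eq_zero_or_pos m with hm0 | hmpos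
  · subst hm0
    have h1 : uniformProb 0 {w : List Bool | U.ktAt PW x + ((0 : ℕ) : ℕ∞) ≤ U.ktAt t (x ++ w) + Nat.log 2 PW} = 1 := by
      refine uniformProb_eq_one_of_forall fun w hw => ?_
      rw [List.length_eq_zero_iff] at hw
      subst hw
      simp only [Set.mem_setOf_eq, Nat.cast_zero, add_zero, List.append_nil]
      exact (U.ktAt_anti hPWt x).trans (le_add_right le_rfl)
    rw [h1]
    have : (0 : ℝ) ≤ 1 / e := by positivity
    linarith
  -- `n = 0`: counting
  rcases Nat.eq_zero_or_pos n with hn0 | hnpos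
  · have hx0 : x = [] := List.length_eq_zero_iff.1 (hx.trans hn0)
    have hKx : U.ktAt PW x ≤ (a₀ : ℕ) := by
      have := hprint x PW hPWc₀
      rw [hx0] at this ⊢
      simpa using this
    refine counting_regime U x he hKx (g := Nat.log 2 (2 * e) + 1) ?_ (two_mul_lt_two_pow_log e)
    have : Nat.log 2 (2 * e) ≤ LZ := by
      refine (Nat.log_mono_right ?_).trans hlogZ
      rw [hZ]; unfold Zf; omega
    omega
  -- now `n, m ≥ 1`, so `n, m ≤ t ≤ v`
  have hnt : n ≤ t := by have := Nat.le_mul_of_pos_right n hmpos; omega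
  have hmt : m ≤ t := by have := Nat.le_mul_of_pos_left m hnpos; omega
  have hnv : n ≤ v := hnt.trans htv
  have hmv : m ≤ v := hmt.trans htv
  -- the parameters
  set kmax := n + a₀ with hkmax
  set W := Nat.log 2 (kmax * n + kmax + m) + 1 with hW
  set T := Tf a₀ dD v with hT
  set Nbar := T + n + kmax + m + 2 * e + W with hNbar
  have hkmaxv : kmax ≤ v + a₀ := by rw [hkmax]; omega
  have hkmaxn : kmax * n ≤ (v + a₀) * v := Nat.mul_le_mul hkmaxv hnv
  have hNbar_le : Nbar ≤ Nb a₀ dD v := by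
    have hW' : W ≤ Wb a₀ v := by
      rw [hW]; unfold Wb Yb
      refine Nat.succ_le_succ (Nat.log_mono_right ?_)
      omega
    rw [hNbar]; unfold Nb; rw [← hT]; omega
  -- `K̄ = K^{p(N̄)}(x)` as a natural number
  have hKbar_le : U.ktAt (p.eval Nbar) x ≤ (kmax : ℕ) := by
    have := hprint x (p.eval Nbar) (hpc₀ _); rw [hx] at this; exact_mod_cast this
  have hKbar_ne : U.ktAt (p.eval Nbar) x ≠ ⊤ := ne_top_of_le_ne_top (ENat.coe_ne_top _) hKbar_le
  obtain ⟨Kbar, hKbar'⟩ := ENat.ne_top_iff_exists.mp hKbar_ne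
  have hKbar : U.ktAt (p.eval Nbar) x = Kbar := hKbar'.symm
  have hKbar_kmax : Kbar ≤ kmax := by have := hKbar_le; rw [hKbar] at this; exact_mod_cast this
  set Lbar := Nat.log 2 (p.eval Nbar) with hLbar
  -- `p(N̄) ≤ PW`, so `K^{PW}(x) ≤ K̄`
  have hpNbar_Z : p.eval Nbar + 2 ≤ Z := by
    have : p.eval Nbar ≤ p.eval (Nb a₀ dD v) := TM2Iter.eval_mono p hNbar_le
    rw [hZ]; unfold Zf; omega
  have hpNbar_PW : p.eval Nbar ≤ PW := by rw [hPW]; omega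
  have hKPW : U.ktAt PW x ≤ (Kbar : ℕ) := by rw [← hKbar]; exact U.ktAt_anti hpNbar_PW x
  have hLbar_le : Lbar ≤ LZ := (Nat.log_mono_right (by omega : p.eval Nbar ≤ Z)).trans hlogZ
  have hW_le : W ≤ LZ + 1 := by
    rw [hW]
    refine Nat.succ_le_succ ((Nat.log_mono_right ?_).trans hlogZ)
    have : kmax * n + kmax + m ≤ Yb a₀ v := by unfold Yb; omega
    rw [hZ]; unfold Zf; omega
  have hL2e_le : Nat.log 2 (2 * e) ≤ LZ := by
    refine (Nat.log_mono_right ?_).trans hlogZ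
    rw [hZ]; unfold Zf; omega
  -- the advice budget `k`
  set k := Kbar - 2 * W - Lbar - 1 with hkdef
  rcases Nat.eq_zero_or_pos k with hk0 | hkpos
  · -- counting regime: `K̄ ≤ 2W + L̄ + 1`
    have hG : Kbar ≤ 2 * W + Lbar + 1 := by omega
    refine counting_regime U x he (hKPW.trans (by exact_mod_cast hG)) (g := Nat.log 2 (2 * e) + 1) ?_ (two_mul_lt_two_pow_log e)
    omega
  -- main regime: `1 ≤ k ≤ kmax`
  have hk_le : k ≤ kmax := by omega
  have hkK : k + 2 * W + Lbar + 1 = Kbar := by omega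
  set Y := n * k + k + m with hY
  have hkv : k ≤ v + a₀ := by omega
  have hnk : n * k ≤ (v + a₀) * v := by rw [mul_comm (v + a₀)]; exact Nat.mul_le_mul hnv hkv
  have hnk' : n * k ≤ kmax * n := by rw [mul_comm kmax]; exact Nat.mul_le_mul_left n hk_le
  have hY_le : Y ≤ Yb a₀ v := by rw [hY]; unfold Yb; omega
  set Lτ := Nat.log 2 (τ.eval (Y + T)) with hLτ
  have hLτ_le : Lτ ≤ LZ := by
    refine (Nat.log_mono_right ?_).trans hlogZ
    have h1 := hdτ (Y + T)
    have h2 : (Y + T + 2) ^ (2 ^ dτ) ≤ (Yb a₀ v + Tf a₀ dD v + 2) ^ (2 ^ dτ) := Nat.pow_le_pow_left (by omega) _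
    rw [hZ]; unfold Zf; omega
  set L2e := Nat.log 2 (2 * e) with hL2e
  -- short instances: everything is logarithmic
  by_cases hshort : Y < Lτ + L2e + 3
  · have hall : ∀ w : List Bool, w.length = m → w ∈ {w : List Bool | U.ktAt PW x + m ≤ U.ktAt t (x ++ w) + Nat.log 2 PW} := by
      intro w _
      simp only [Set.mem_setOf_eq]
      have hnm : n + m ≤ Y := by
        have : n * 1 ≤ n * k := Nat.mul_le_mul_left n hkpos
        omega
      have h1 : (Kbar : ℕ∞) + m ≤ (Nat.log 2 PW : ℕ) := by
        have : Kbar + m ≤ Nat.log 2 PW := by omega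
        exact_mod_cast this
      calc U.ktAt PW x + m ≤ (Kbar : ℕ∞) + m := add_le_add hKPW le_rfl
        _ ≤ (Nat.log 2 PW : ℕ) := h1
        _ ≤ U.ktAt t (x ++ w) + Nat.log 2 PW := le_add_self
    rw [uniformProb_eq_one_of_forall hall]
    have : (0 : ℝ) ≤ 1 / e := by positivity
    linarith
  push Not at hshort
  -- the threshold `s` and its fixed-width numeral
  set s := Y - Lτ - L2e - 3 with hs
  have hsY : s + Lτ + 1 + (L2e + 2) = Y := by omega
  have hs_le : s ≤ kmax * n + kmax + m := by omega
  set bs : List Bool := encodeNat s ++ List.replicate (W - (encodeNat s).length) false with hbsdef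
  have hbs_len0 : (encodeNat s).length ≤ W := DPKProg.length_encodeNat_le_of_le hs_le
  have hbs_len : bs.length = W := by rw [hbsdef, List.length_append, List.length_replicate]; omega
  have hbs_val : bitsToNat bs = s := by rw [hbsdef, bitsToNat_append, bitsToNat_replicate_false, bitsToNat_encodeNat]; simp
  set a : List Bool := boolPair (unaryEncodeNat T) bs with ha
  -- (I) few uniform strings pass the test
  have hI : uniformProb Y {y | boolPair a y ∈ WSOIProg.testLang LA} ≤ 1 / (2 * (e : ℝ)) :=
    uniformProb_test_le U hno he hbs_val (by show s + Lτ + 1 + (L2e + 2) ≤ Y; omega)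
  -- (II) the `DP` samples pass the test with probability `< 1/e`
  have hII : uniformProb (n * k + m) {zr | boolPair a (dpGen k x (zr.take (n * k)) ++ zr.drop (n * k)) ∈ WSOIProg.testLang LA} < 1 / (e : ℝ) := by
    by_contra hge
    push Not at hge
    -- the test `1/2e`-distinguishes, so Thm. 3.12 applies with `e' = 2e`
    have hgap : 1 / ((2 * e : ℕ) : ℝ) ≤ |uniformProb (x.length * k + m)
          {zr | boolPair (boolPair (unaryEncodeNat T) bs) (dpGen k x (zr.take (x.length * k)) ++ zr.drop (x.length * k)) ∈ WSOIProg.testLang LA} -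
        uniformProb (x.length * k + k + m) {y | boolPair (boolPair (unaryEncodeNat T) bs) y ∈ WSOIProg.testLang LA}| := by
      rw [hx, ← ha, ← hY]
      refine le_trans ?_ (le_abs_self _)
      have hsplit2 : (1 : ℝ) / e = 2 * (1 / (2 * e)) := by field_simp
      push_cast
      linarith
    have hK := hp T bs x k m (2 * e) (by omega) hgap
    rw [hx, hbs_len] at hK
    -- `N ≤ N̄`
    have hN : T + n + k + m + 2 * e + W ≤ Nbar := by rw [hNbar]; omega
    have hmono : p.eval (T + n + k + m + 2 * e + W) ≤ p.eval Nbar := TM2Iter.eval_mono p hN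
    have h1 : U.ktAt (p.eval Nbar) x ≤ ((k + 2 * W + Nat.log 2 (p.eval (T + n + k + m + 2 * e + W))) : ℕ) :=
      (U.ktAt_anti hmono x).trans hK
    rw [hKbar] at h1
    have h2 : Kbar ≤ k + 2 * W + Nat.log 2 (p.eval (T + n + k + m + 2 * e + W)) := by exact_mod_cast h1
    have h3 : Nat.log 2 (p.eval (T + n + k + m + 2 * e + W)) ≤ Lbar := Nat.log_mono_right hmono
    omega
  -- (III) off the accepted samples, `K^t(xw)` is large
  set E : Set (List Bool) := {w | U.ktAt PW x + m ≤ U.ktAt t (x ++ w) + Nat.log 2 PW} with hE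
  have hIII : ∀ z w : List Bool, z.length = n * k → w.length = m →
      boolPair a (dpGen k x z ++ w) ∉ WSOIProg.testLang LA → w ∈ E := by
    intro z w hz hw hnot
    -- not a yes-instance: `K^T(DP_k(x;z) w) > s`
    have hylen : (dpGen k x z ++ w).length = Y := by rw [List.length_append, length_dpGen, hz, hw, hY]
    rw [ha, unary_eq_ones, WSOIProg.boolPair_mem_testLang, hbs_val, hylen, min_eq_left (by omega), ← unary_eq_ones, ← unary_eq_ones] at hnot
    have hnotyes : boolPair (dpGen k x z ++ w) (boolPair (unaryEncodeNat T) (unaryEncodeNat s)) ∉ (U.gapKvsK fun m => τ.eval m).yes :=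
      fun h => hnot (hyes h)
    rw [U.boolPair_mem_gapKvsK_yes_iff, not_le] at hnotyes
    -- a shortest program for `xw`
    have hKxw_le : U.ktAt t (x ++ w) ≤ ((n + m + a₀ : ℕ) : ℕ∞) := by
      have := hprint (x ++ w) t hc₀t; rw [List.length_append, hx, hw] at this; exact_mod_cast this
    have hKxw_ne : U.ktAt t (x ++ w) ≠ ⊤ := ne_top_of_le_ne_top (ENat.coe_ne_top _) hKxw_le
    obtain ⟨Kxw, hKxw'⟩ := ENat.ne_top_iff_exists.mp hKxw_ne
    have hKxw : U.ktAt t (x ++ w) = Kxw := hKxw'.symm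
    have hKxw_nat : Kxw ≤ n + m + a₀ := by have := hKxw_le; rw [hKxw] at this; exact_mod_cast this
    obtain ⟨prog, hrun, hproglt⟩ := U.exists_run_eq_of_ktAt_lt (show U.ktAt t (x ++ w) < ((Kxw + 1 : ℕ) : ℕ∞) by
      rw [hKxw]; exact_mod_cast Nat.lt_succ_self _)
    have hprog : prog.length ≤ Kxw := by have : (prog.length : ℕ∞) < ((Kxw + 1 : ℕ) : ℕ∞) := hproglt; exact Nat.lt_succ_iff.1 (by exact_mod_cast this)
    -- the description bound
    set uD : List Bool := ones (Nat.log 2 (n + kmax + t) + 1) with huD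
    have huDl : uD.length = Nat.log 2 (n + kmax + t) + 1 := List.length_replicate ..
    have hRu : n + kmax + t < 2 ^ uD.length := by rw [huDl]; exact Nat.lt_pow_succ_log_self one_lt_two _
    have hz' : z.length = k * n := by rw [hz, mul_comm]
    have hdesc := hD uD n k t x w z prog hx hz' hrun (by omega) (by omega) (by omega)
    -- its budget is below `T`
    have hRD : n + kmax + t ≤ RDb a₀ v := by unfold RDb; omega
    have h2u : 2 ^ uD.length ≤ 2 * RDb a₀ v := by
      rw [huDl, pow_succ]
      have := Nat.pow_log_le_self 2 (show n + kmax + t ≠ 0 by omega)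
      omega
    have hnums : (WSOIProg.numsD n k t).length ≤ 5 * (Nat.log 2 (RDb a₀ v) + 1) + 4 :=
      WSOIProg.length_numsD_le (by omega) (by omega) (by omega)
    have hpayD : (WSOIProg.payloadD n k t z prog).length ≤ PLDb a₀ v := by
      rw [WSOIProg.length_payloadD, hz]
      unfold PLDb
      omega
    have hbudget : qD.eval (2 ^ uD.length + (WSOIProg.payloadD n k t z prog).length) ≤ T := by
      have h1 := hdD (2 ^ uD.length + (WSOIProg.payloadD n k t z prog).length)
      have h2 : (2 ^ uD.length + (WSOIProg.payloadD n k t z prog).length + 2) ^ (2 ^ dD) ≤ (2 * RDb a₀ v + PLDb a₀ v + 2) ^ (2 ^ dD) :=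
        Nat.pow_le_pow_left (by omega) _
      rw [hT]; unfold Tf; omega
    have hchain : ((s : ℕ) : ℕ∞) < ((WSOIProg.payloadD n k t z prog).length + 2 * uD.length + cD : ℕ) := by
      calc ((s : ℕ) : ℕ∞) < U.ktAt T (dpGen k x z ++ w) := hnotyes
        _ ≤ U.ktAt (qD.eval (2 ^ uD.length + (WSOIProg.payloadD n k t z prog).length)) (dpGen k x z ++ w) := U.ktAt_anti hbudget _
        _ ≤ _ := hdesc
        _ = _ := by push_cast; ring
    have hchain' : s < (WSOIProg.payloadD n k t z prog).length + 2 * uD.length + cD := by exact_mod_cast hchain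
    rw [WSOIProg.length_payloadD, hz] at hchain'
    -- logarithms
    have hlogRD : Nat.log 2 (RDb a₀ v) ≤ LZ := by
      refine (Nat.log_mono_right ?_).trans hlogZ
      rw [hZ]; unfold Zf; omega
    have huD_le : uD.length ≤ LZ + 1 := by
      rw [huDl]; exact Nat.succ_le_succ ((Nat.log_mono_right hRD).trans hlogRD)
    -- assemble the lower bound on `K^t(xw)`
    simp only [hE, Set.mem_setOf_eq, hKxw]
    have hfinal : Kbar + m ≤ Kxw + Nat.log 2 PW := by omega
    calc U.ktAt PW x + m ≤ (Kbar : ℕ∞) + m := add_le_add hKPW le_rfl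
      _ ≤ (Kxw : ℕ∞) + (Nat.log 2 PW : ℕ) := by exact_mod_cast hfinal
  -- (IV) hence `Pr_w[E] > 1 - 1/e`
  have hcompl : uniformProb m E = 1 - uniformProb m Eᶜ := by rw [uniformProb_compl]; ring
  rw [hcompl]
  have hbad : uniformProb m Eᶜ ≤ uniformProb (n * k + m) {zr | boolPair a (dpGen k x (zr.take (n * k)) ++ zr.drop (n * k)) ∈ WSOIProg.testLang LA} := by
    have hsplit : uniformProb m Eᶜ = uniformProb (n * k + m) {zr | zr.drop (n * k) ∈ Eᶜ} := by
      have h := DPKCirc.uniformProb_split (n * k) m (fun _ w => w ∈ Eᶜ)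
      rw [h, FineGrained.Schoening.uniformAvg_const, Set.setOf_mem_eq]
    rw [hsplit]
    refine uniformProb_mono_len fun zr hzr hbadzr => ?_
    by_contra hA
    have hz : (zr.take (n * k)).length = n * k := by rw [List.length_take]; omega
    have hw : (zr.drop (n * k)).length = m := by rw [List.length_drop]; omega
    exact hbadzr (hIII _ _ hz hw hA)
  linarith [hII]

end WSOI

export WSOI (Hirahara2021_weakSOI_of_PRG)

end Literature.Computability.MetaComplexity

end
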